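/-
Copyright (c) 2026 the pub-hodgecm-mathlib formalisation cell (harness21).  Prover seat hodgecm-mathlib-A-p19 (g26): T3′ P-2 row (R2²) organ [T2-d] sub-head (D3)
«THE BRIDGE `E × K₁ ≅ E[δ_w] ⊂ M₃(E)` AND THE TRANSPORT OF `[C : R^×]`» (road «S3-tree», crux H413).
-/
import Literature.NumberTheory.Automorphic.QuadraticRamifiedOrderNormIndex   -- ★ p846601 (this seat): [T2-c] `relIndex_units_comap_norm_eq` and its currency (`eval₂RingHom (RingHom.prod (RingHom.id 𝒪) j) (u, lam)`)
import Mathlib.RingTheory.AdjoinRoot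
import Mathlib.LinearAlgebra.Matrix.Charpoly.Basic
import HarnessLib

/-!
# The bridge `E × K ≅ E[τ] ⊂ M₃(E)` for a type-(2) torus element and the transport of the unit index `[C : R^×]` to the coordinate ring `E × K`

Topic `NumberTheory/Automorphic`; namespace `Literature.NumberTheory.Automorphic`.  THEOREMS ONLY (no definition, no instance, no notation, no named fact, no `sorry`); (D0) currency with two
valued fields `E`, `K` (`K` an `E`-algebra: the ramified quadratic eigen-field `K₁ = E(λ₁)` of a type-(2) class; `[Algebra E K]` is ASSUMED, never declared).  Cell `pub/hodgecm-mathlib`,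
crux H413 = `stmt-HodgeConjecture-24833`; road «S3-tree», T3′ P-2 row (R2²) «THE FREE ROW, TYPE (2)» (architect A-p16 (g30) A-145), organ [T2-d] sub-head (D3): the glue between ★ [T2-a]
`CyclicSelfDualLatticeTorsor.ncard_setOf_selfDual_cyclic_eq_relIndex` (F0P3b-p01 (g12); wants `φ : B →ₐ[E] M₃(E)` injective with `φ τB = τ`, `star`, `RB`) at `B := E × K`, and ★ [T2-c]
`QuadraticRamifiedOrderNormIndex.relIndex_units_comap_norm_eq` (this seat; lives in `(𝒪_E × 𝒪_K)ˣ`).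
HONEST LABEL: HC_CM is proved only modulo the 2 remaining named inputs (hLiu418 24832, h413 24833) until rung 0 closes; commutative algebra, asserts nothing printed.

THE MATHEMATICS.  `τ ∈ M₃(E)` is killed by the monic cubic `f = (X − u)(X² − tX + D)` whose quadratic factor `χ` has NO root in `E` but the root `λ₁ ∈ K = E ⊕ Eλ₁`; a CYCLIC vector `w₀`
(invertible Krylov matrix) makes `p(τ) = 0 ⇒ f ∣ p`.  Hence `E[X]⁄(f) → M₃(E)`, `X ↦ τ` is injective and `E[X]⁄(f) → E × K`, `X ↦ x₀ := (u, λ₁)` is bijective (injective: `(X−u) ∣ p` and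
`χ ∣ p` are coprime conditions; surjective: `p = p₀ + q₀X + cχ` hits `(a, p₀ + q₀λ₁)`), giving **`φ : E × K →ₐ[E] M₃(E)`, injective, `φ x₀ = τ`, `φ(p(x₀)) = p(τ)`**.  For a `σ`-hermitian `J`
with `(στ)ᵀJτ = J` and `star = (σ, σ_K)` with `x₀·star x₀ = 1`: **`J·φ(star b) = (σφb)ᵀ·J`** (both are `Σ σ(pᵢ) J τ^{−i}`).  With `RB := 𝒪_E[x₀]` (★ [T2-c]'s `R` pushed into `E × K`):
`φ(RB) = 𝒪_E[τ]`, and the unit groups `RB^×`, `C_B = {c : c·star c ∈ RB^×}` are the images of ★ [T2-c]'s `R^×`, `C` under the injective `(𝒪_E × 𝒪_K)ˣ → (E × K)ˣ` (a `c` with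
`c·star c ∈ 𝒪^×` is integral: `|σz| = |z|`), so **`[C_B : RB^×] = [C : R^×]`** (Mathlib `Subgroup.relIndex_map_map_of_injective`).

* §1 `valuation_map_eq_of_involutive`; §2 the cubic: `aeval_prod_cubic_eq_zero`, `dvd_of_aeval_matrix_eq_zero`, `dvd_of_eval_eq_zero_of_aeval_eq_zero`;
  §3 **`exists_algHom_prod`**; §4 `transpose_map_aeval_mul_eq`, **`hstar_of_algHom_prod`**; §5 `mem_adjoin_integer_iff_exists_mem_map`; §6 **`relIndex_units_map_prod_eq`**.

## References
* [Lang2002] S. Lang, *Algebra*, GTM 211 (2002): Ch. XIV §2–§3 (cyclic endomorphisms, `E[X]⁄(f)`), Ch. II §2 (Chinese remainder theorem).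
* [Rogawski1990] J. D. Rogawski, *Automorphic Representations of Unitary Groups in Three Variables* (1990): §4.9 Lemma 4.9.3 p. 56.
* [Jacobowitz1962] R. Jacobowitz, *Hermitian forms over local fields*, Amer. J. Math. 84 (1962): §7.
-/

set_option autoImplicit false

noncomputable section

open scoped ValuativeRel Matrix MatrixGroups
open Polynomial Matrix ValuativeRel

namespace Literature.NumberTheory.Automorphic

/-! ## §1 An involution preserving the valuation ring is isometric -/

/-- A ring involution of a valued field mapping `𝒪` into `𝒪` preserves the valuation (`σz∕z ∈ 𝒪` and `z∕σz ∈ 𝒪`). [cite: Lang2002, Ch. XII §4] -/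
theorem valuation_map_eq_of_involutive {K : Type*} [Field K] [ValuativeRel K] (s : K →+* K) (hss : ∀ z, s (s z) = z)
    (hsO : ∀ z : 𝒪[K], s z ∈ 𝒪[K]) (z : K) : valuation K (s z) = valuation K z := by
  by_cases hz : z = 0
  · rw [hz, map_zero]
  have hsz : s z ≠ 0 := fun h => hz (by rw [← hss z, h, map_zero])
  -- `|s w| ≤ |w|`-type comparison in both directions via integrality of quotients
  have key : ∀ w : K, w ≠ 0 → valuation K (s w) ≤ valuation K w := by
    intro w hw
    by_contra hlt
    push Not at hlt
    -- `q := w / s w ∈ 𝔪`, but `s q = s w / w ∉ 𝒪`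
    have hsw : s w ≠ 0 := fun h => hw (by rw [← hss w, h, map_zero])
    have hq : valuation K (w / s w) < 1 := by
      rw [map_div₀, div_lt_one₀ ((Valuation.pos_iff _).2 hsw)]; exact hlt
    have hqO : w / s w ∈ 𝒪[K] := (Valuation.mem_integer_iff _ _).2 hq.le
    have hsq := hsO ⟨_, hqO⟩
    have hsq' : valuation K (s w / w) ≤ 1 := by
      have : s (w / s w) = s w / w := by rw [map_div₀, hss]
      rw [← this]; exact (Valuation.mem_integer_iff _ _).1 hsq
    rw [map_div₀, div_le_one₀ ((Valuation.pos_iff _).2 hw)] at hsq'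
    exact absurd hsq' (not_le.2 hlt)
  exact le_antisymm (key z hz) (by simpa only [hss] using key (s z) hsz)

/-! ## §2 The cubic `f = (X − u)(X² − tX + D)`: Cayley–Hamilton input, the cyclic vector, and the two divisibilities -/

section Cubic

variable {E : Type*} [Field E] {K : Type*} [Field K] [Algebra E K] (u t D : E) (lam : K)

/-- `f = X³ − (t+u)X² + (D+tu)X − uD` kills `x₀ = (u, λ₁)` when `λ₁² − tλ₁ + D = 0`. [cite: Lang2002, Ch. II §2] -/
theorem aeval_prod_cubic_eq_zero (hlam : lam ^ 2 - algebraMap E K t * lam + algebraMap E K D = 0) :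
    aeval ((u, lam) : E × K) (C 1 * X ^ 3 + C (-(t + u)) * X ^ 2 + C (D + t * u) * X + C (-(u * D))) = 0 := by
  simp only [map_add, map_mul, aeval_C, aeval_X_pow, aeval_X, map_one, one_mul, map_neg]
  refine Prod.ext ?_ ?_
  · simp only [Prod.fst_add, Prod.fst_mul, Prod.pow_fst, Prod.fst_neg, Prod.fst_zero, Prod.algebraMap_apply, Algebra.algebraMap_self, RingHom.id_apply]
    ring
  · simp only [Prod.snd_add, Prod.snd_mul, Prod.pow_snd, Prod.snd_neg, Prod.snd_zero, Prod.algebraMap_apply]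
    calc lam ^ 3 + -(algebraMap E K t + algebraMap E K u) * lam ^ 2 + (algebraMap E K D + algebraMap E K t * algebraMap E K u) * lam + -(algebraMap E K u * algebraMap E K D)
        = (lam - algebraMap E K u) * (lam ^ 2 - algebraMap E K t * lam + algebraMap E K D) := by ring
      _ = 0 := by rw [hlam, mul_zero]

/-- The Krylov matrix acts on a coefficient vector as the corresponding combination of the `τ^j w`. [cite: Lang2002, Ch. XIV §3] -/
theorem krylov_mulVec_eq_sum (τ : Matrix (Fin 3) (Fin 3) E) (w : Fin 3 → E) (c : Fin 3 → E) :
    (Matrix.of fun i j : Fin 3 => ((τ ^ (j : ℕ)) *ᵥ w) i) *ᵥ c = ∑ j : Fin 3, c j • ((τ ^ (j : ℕ)) *ᵥ w) := by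
  funext i
  simp only [Matrix.mulVec, dotProduct, Matrix.of_apply, Finset.sum_apply, Pi.smul_apply, smul_eq_mul]
  exact Finset.sum_congr rfl fun j _ => mul_comm _ _

/-- A polynomial of degree `< 3` acts on `w` through the Krylov matrix: `r(τ) w = K(w) · (r₀, r₁, r₂)`. [cite: Lang2002, Ch. XIV §3] -/
theorem aeval_mulVec_eq_krylov_mulVec (τ : Matrix (Fin 3) (Fin 3) E) (w : Fin 3 → E) {r : E[X]} (hr : r.natDegree < 3) :
    aeval τ r *ᵥ w = (Matrix.of fun i j : Fin 3 => ((τ ^ (j : ℕ)) *ᵥ w) i) *ᵥ fun j : Fin 3 => r.coeff j := by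
  rw [krylov_mulVec_eq_sum, aeval_eq_sum_range' hr, Matrix.sum_mulVec, Finset.sum_range, Fin.sum_univ_three, Fin.sum_univ_three]
  simp only [Matrix.smul_mulVec, Fin.val_zero, Fin.val_one, Fin.val_two]

/-- **A CYCLIC VECTOR MAKES `p(τ) = 0 ⇒ f ∣ p`** (`f` the monic cubic with `f(τ) = 0`): reduce `p` modulo `f`; a polynomial of degree `< 3` killing `τ` kills the cyclic vector `w₀`
through the invertible Krylov matrix, so it vanishes. [cite: Lang2002, Ch. XIV §2 Thm. 2.1] -/
theorem dvd_of_aeval_matrix_eq_zero (τ : Matrix (Fin 3) (Fin 3) E)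
    (hfτ : aeval τ (C 1 * X ^ 3 + C (-(t + u)) * X ^ 2 + C (D + t * u) * X + C (-(u * D))) = 0)
    {w₀ : Fin 3 → E} (hK : IsUnit (Matrix.of fun i j : Fin 3 => ((τ ^ (j : ℕ)) *ᵥ w₀) i).det)
    {p : E[X]} (hp : aeval τ p = 0) : (C 1 * X ^ 3 + C (-(t + u)) * X ^ 2 + C (D + t * u) * X + C (-(u * D))) ∣ p := by
  classical
  set f : E[X] := C 1 * X ^ 3 + C (-(t + u)) * X ^ 2 + C (D + t * u) * X + C (-(u * D)) with hf
  have hfm : f.Monic := by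
    change f.leadingCoeff = 1; rw [hf]; exact leadingCoeff_cubic one_ne_zero
  have hfdeg : f.natDegree = 3 := by rw [hf]; exact natDegree_cubic one_ne_zero
  have hf1 : f ≠ 1 := by
    intro h
    have h0 : f.natDegree = 0 := by rw [h]; exact natDegree_one
    omega
  rw [← modByMonic_eq_zero_iff_dvd hfm]
  set r := p %ₘ f with hr
  have hr0 : aeval τ r = 0 := by
    have : aeval τ p = aeval τ r := by
      conv_lhs => rw [← modByMonic_add_div p f]
      rw [map_add, map_mul, hfτ, zero_mul, add_zero]
    rw [← this, hp]
  have hlt : r.natDegree < 3 := hfdeg ▸ natDegree_modByMonic_lt p hfm hf1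
  set Kw := Matrix.of fun i j : Fin 3 => ((τ ^ (j : ℕ)) *ᵥ w₀) i with hKw
  have hKc : Kw *ᵥ (fun j : Fin 3 => r.coeff j) = 0 := by
    rw [← aeval_mulVec_eq_krylov_mulVec τ w₀ hlt, hr0, Matrix.zero_mulVec]
  have hc : (fun j : Fin 3 => r.coeff j) = 0 := by
    have h := congrArg (fun v => Kw⁻¹ *ᵥ v) hKc
    simp only [Matrix.mulVec_mulVec, Matrix.nonsing_inv_mul _ hK, Matrix.one_mulVec, Matrix.mulVec_zero] at h
    exact h
  ext k
  rw [coeff_zero]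
  by_cases hk : k < 3
  · have := congrFun hc ⟨k, hk⟩
    simpa using this
  · exact coeff_eq_zero_of_natDegree_lt (by omega)

/-- **`p(u) = 0` AND `p(λ₁) = 0` FORCE `f ∣ p`** when `χ = X² − tX + D` has the root `λ₁ ∈ K` but no root in `E` (`χ ∣ p`: the remainder `r₁X + r₀` of `p` mod `χ` has `r₁λ₁ + r₀ = 0`,
and `r₁ ≠ 0` would put `λ₁` in `E`) and `χ(u) ≠ 0` (`X − u`, `χ` coprime). [cite: Lang2002, Ch. II §2; Ch. IV §1] -/
theorem dvd_of_eval_eq_zero_of_aeval_eq_zero (hlam : lam ^ 2 - algebraMap E K t * lam + algebraMap E K D = 0) (hirr : ∀ x : E, x * x - t * x + D ≠ 0)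
    {p : E[X]} (hpu : p.eval u = 0) (hpl : aeval lam p = 0) :
    (C 1 * X ^ 3 + C (-(t + u)) * X ^ 2 + C (D + t * u) * X + C (-(u * D))) ∣ p := by
  classical
  set χ : E[X] := C 1 * X ^ 2 + C (-t) * X + C D with hχ
  have hχm : χ.Monic := by
    change χ.leadingCoeff = 1; rw [hχ]; exact leadingCoeff_quadratic one_ne_zero
  have hχdeg : χ.natDegree = 2 := by rw [hχ]; exact natDegree_quadratic one_ne_zero
  have hχ1 : χ ≠ 1 := by
    intro h
    have h0 : χ.natDegree = 0 := by rw [h]; exact natDegree_one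
    omega
  have hfac : (C 1 * X ^ 3 + C (-(t + u)) * X ^ 2 + C (D + t * u) * X + C (-(u * D)) : E[X]) = (X - C u) * χ := by
    rw [hχ]; simp only [map_one, one_mul, map_neg, map_add, map_mul]; ring
  rw [hfac]
  have hχl : aeval lam χ = 0 := by
    rw [hχ]; simp only [map_add, map_mul, aeval_C, aeval_X_pow, aeval_X, map_one, one_mul, map_neg]
    linear_combination hlam
  -- `χ ∣ p`
  have hχp : χ ∣ p := by
    rw [← modByMonic_eq_zero_iff_dvd hχm]
    set r := p %ₘ χ with hr
    have hlt : r.natDegree < 2 := hχdeg ▸ natDegree_modByMonic_lt p hχm hχ1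
    have hrl : aeval lam r = 0 := by
      have : aeval lam p = aeval lam r := by
        conv_lhs => rw [← modByMonic_add_div p χ]
        rw [map_add, map_mul, hχl, zero_mul, add_zero]
      rw [← this, hpl]
    have hr1 : r = C (r.coeff 1) * X + C (r.coeff 0) := eq_X_add_C_of_natDegree_le_one (by omega)
    rw [hr1] at hrl
    simp only [map_add, map_mul, aeval_C, aeval_X] at hrl
    -- `r₁ = 0` (else `λ₁ ∈ E` is a root of `χ`) and then `r₀ = 0`
    have h1 : r.coeff 1 = 0 := by
      by_contra hne
      have hlamE : lam = algebraMap E K (-(r.coeff 0) / r.coeff 1) := by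
        rw [map_div₀, map_neg, eq_div_iff ((_root_.map_ne_zero _).2 hne)]
        linear_combination hrl
      apply hirr (-(r.coeff 0) / r.coeff 1)
      have h := hlam
      rw [hlamE, ← map_pow, ← map_mul, ← map_sub, ← map_add, map_eq_zero] at h
      rw [← h]; ring
    rw [h1, map_zero, zero_mul, zero_add, map_eq_zero] at hrl
    rw [hr1, h1, hrl, map_zero, zero_mul, zero_add]
  have hXp : (X - C u) ∣ p := dvd_iff_isRoot.2 hpu
  have hcop : IsCoprime (X - C u) χ := by
    rw [(irreducible_X_sub_C u).coprime_iff_not_dvd, dvd_iff_isRoot]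
    intro hroot
    apply hirr u
    have : χ.eval u = u * u - t * u + D := by rw [hχ]; simp; ring
    rw [← this]; exact hroot
  exact hcop.mul_dvd hXp hχp

end Cubic

/-! ## §3 The bridge `φ : E × K →ₐ[E] M₃(E)` -/

section Bridge

variable {E : Type*} [Field E] {K : Type*} [Field K] [Algebra E K] (u t D : E) (lam : K)
  (τ : Matrix (Fin 3) (Fin 3) E)
  (hfτ : aeval τ (C 1 * X ^ 3 + C (-(t + u)) * X ^ 2 + C (D + t * u) * X + C (-(u * D))) = 0)
  {w₀ : Fin 3 → E} (hK : IsUnit (Matrix.of fun i j : Fin 3 => ((τ ^ (j : ℕ)) *ᵥ w₀) i).det)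
  (hlam : lam ^ 2 - algebraMap E K t * lam + algebraMap E K D = 0) (hirr : ∀ x : E, x * x - t * x + D ≠ 0)
  (hχu : u * u - t * u + D ≠ 0) (hcoordlam : ∀ z : K, ∃ p q : E, z = algebraMap E K p + algebraMap E K q * lam)

include hχu hcoordlam in
/-- **EVERY ELEMENT OF `E × K` IS A POLYNOMIAL IN `x₀ = (u, λ₁)`**: `(a, p₀ + q₀λ₁) = P(x₀)` with `P = p₀ + q₀X + c·χ`, `c = (a − p₀ − q₀u)∕χ(u)`. [cite: Lang2002, Ch. II §2] -/
theorem exists_aeval_prod_eq (hlam : lam ^ 2 - algebraMap E K t * lam + algebraMap E K D = 0) (b : E × K) :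
    ∃ P : E[X], aeval ((u, lam) : E × K) P = b := by
  obtain ⟨a, z⟩ := b
  obtain ⟨p₀, q₀, hz⟩ := hcoordlam z
  set c : E := (a - p₀ - q₀ * u) / (u * u - t * u + D) with hc
  refine ⟨C p₀ + C q₀ * X + C c * (C 1 * X ^ 2 + C (-t) * X + C D), ?_⟩
  simp only [map_add, map_mul, aeval_C, aeval_X_pow, aeval_X, map_one, one_mul, map_neg]
  refine Prod.ext ?_ ?_
  · simp only [Prod.fst_add, Prod.fst_mul, Prod.pow_fst, Prod.fst_neg, Prod.algebraMap_apply, Algebra.algebraMap_self, RingHom.id_apply]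
    have hcd : c * (u * u - t * u + D) = a - p₀ - q₀ * u := by rw [hc]; exact div_mul_cancel₀ _ hχu
    linear_combination hcd
  · simp only [Prod.snd_add, Prod.snd_mul, Prod.pow_snd, Prod.snd_neg, Prod.algebraMap_apply]
    rw [hz]
    linear_combination (algebraMap E K c) * hlam

include hfτ hK hlam hirr hχu hcoordlam in
/-- **THE BRIDGE.**  `φ : E × K →ₐ[E] M₃(E)`, injective, with `φ(u, λ₁) = τ`: compose the inverse of the bijective evaluation `E[X]⁄(f) → E × K`, `X ↦ (u, λ₁)` with the injective evaluation
`E[X]⁄(f) → M₃(E)`, `X ↦ τ` (§2). [cite: Lang2002, Ch. XIV §3; Ch. II §2] -/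
theorem exists_algHom_prod : ∃ φ : (E × K) →ₐ[E] Matrix (Fin 3) (Fin 3) E, Function.Injective φ ∧ φ ((u, lam) : E × K) = τ := by
  classical
  set f : E[X] := C 1 * X ^ 3 + C (-(t + u)) * X ^ 2 + C (D + t * u) * X + C (-(u * D)) with hf
  set I : Ideal E[X] := Ideal.span {f} with hI
  have hfx : aeval ((u, lam) : E × K) f = 0 := aeval_prod_cubic_eq_zero u t D lam hlam
  have hIM : ∀ a ∈ I, aeval τ a = 0 := by
    intro a ha
    obtain ⟨g, rfl⟩ := Ideal.mem_span_singleton.1 ha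
    rw [map_mul, hfτ, zero_mul]
  have hIP : ∀ a ∈ I, aeval ((u, lam) : E × K) a = 0 := by
    intro a ha
    obtain ⟨g, rfl⟩ := Ideal.mem_span_singleton.1 ha
    rw [map_mul, hfx, zero_mul]
  set ΘM : (E[X] ⧸ I) →ₐ[E] Matrix (Fin 3) (Fin 3) E := Ideal.Quotient.liftₐ I (aeval τ) hIM with hΘM
  set ΘP : (E[X] ⧸ I) →ₐ[E] (E × K) := Ideal.Quotient.liftₐ I (aeval ((u, lam) : E × K)) hIP with hΘP
  have hΘMmk : ∀ p : E[X], ΘM (Ideal.Quotient.mk I p) = aeval τ p := fun p => by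
    rw [hΘM, Ideal.Quotient.liftₐ_apply]; exact Ideal.Quotient.lift_mk I _ hIM
  have hΘPmk : ∀ p : E[X], ΘP (Ideal.Quotient.mk I p) = aeval ((u, lam) : E × K) p := fun p => by
    rw [hΘP, Ideal.Quotient.liftₐ_apply]; exact Ideal.Quotient.lift_mk I _ hIP
  -- injectivity of both evaluations
  have hMinj : Function.Injective ΘM := by
    rw [injective_iff_map_eq_zero]
    intro x hx
    obtain ⟨p, rfl⟩ := Ideal.Quotient.mk_surjective x
    rw [hΘMmk] at hx
    exact Ideal.Quotient.eq_zero_iff_mem.2 (Ideal.mem_span_singleton.2 (dvd_of_aeval_matrix_eq_zero u t D τ hfτ hK hx))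
  have hPinj : Function.Injective ΘP := by
    rw [injective_iff_map_eq_zero]
    intro x hx
    obtain ⟨p, rfl⟩ := Ideal.Quotient.mk_surjective x
    rw [hΘPmk] at hx
    have h1 : p.eval u = 0 := by
      have h : aeval u p = (AlgHom.fst E E K) (aeval ((u, lam) : E × K) p) := by rw [← aeval_algHom_apply]; rfl
      rw [hx, map_zero, coe_aeval_eq_eval] at h
      exact h
    have h2 : aeval lam p = 0 := by
      have h : aeval lam p = (AlgHom.snd E E K) (aeval ((u, lam) : E × K) p) := by rw [← aeval_algHom_apply]; rfl
      rw [hx, map_zero] at h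
      exact h
    exact Ideal.Quotient.eq_zero_iff_mem.2 (Ideal.mem_span_singleton.2 (dvd_of_eval_eq_zero_of_aeval_eq_zero u t D lam hlam hirr h1 h2))
  have hPsurj : Function.Surjective ΘP := by
    intro b
    obtain ⟨P, hP⟩ := exists_aeval_prod_eq u t D lam hχu hcoordlam hlam b
    exact ⟨Ideal.Quotient.mk I P, by rw [hΘPmk, hP]⟩
  set e : (E[X] ⧸ I) ≃ₐ[E] (E × K) := AlgEquiv.ofBijective ΘP ⟨hPinj, hPsurj⟩ with he
  refine ⟨ΘM.comp (e.symm : (E × K) →ₐ[E] (E[X] ⧸ I)), hMinj.comp e.symm.injective, ?_⟩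
  have hroot : e (Ideal.Quotient.mk I X) = ((u, lam) : E × K) := by
    rw [he, AlgEquiv.ofBijective_apply, hΘPmk, aeval_X]
  rw [AlgHom.comp_apply, AlgEquiv.coe_toAlgHom, show e.symm ((u, lam) : E × K) = Ideal.Quotient.mk I X from (e.symm_apply_eq).2 hroot.symm, hΘMmk, aeval_X]

end Bridge

/-! ## §4 Adjoints: `J · φ(star b) = (σ φ b)ᵀ · J` -/

section Adjoint

variable {E : Type*} [Field E] {K : Type*} [Field K] [Algebra E K] (u t D : E) (lam : K) (σ : E →+* E) (σK : K →+* K)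
  (hσK : ∀ x, σK (algebraMap E K x) = algebraMap E K (σ x)) (τ : Matrix (Fin 3) (Fin 3) E) (J : Matrix (Fin 3) (Fin 3) E)

/-- `((σ τ)ᵀ)^n · J = J · (τ⁻¹)^n` from `(στ)ᵀ J = J τ⁻¹`. [cite: Rogawski1990, §4.9 p. 55] -/
theorem transpose_map_pow_mul_eq (hτJ : (τ.map σ)ᵀ * J = J * τ⁻¹) (n : ℕ) : ((τ.map σ)ᵀ) ^ n * J = J * (τ⁻¹) ^ n := by
  induction n with
  | zero => rw [pow_zero, pow_zero, Matrix.one_mul, Matrix.mul_one]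
  | succ n ih => rw [pow_succ, Matrix.mul_assoc, hτJ, ← Matrix.mul_assoc, ih, Matrix.mul_assoc, ← pow_succ]

/-- **`(σ p(τ))ᵀ · J = J · p^σ(τ⁻¹)`** for every polynomial `p` (the adjoint of `p(τ)` w.r.t. a `σ`-hermitian form for which `τ` is unitary). [cite: Rogawski1990, §4.9 p. 55] -/
theorem transpose_map_aeval_mul_eq (hτJ : (τ.map σ)ᵀ * J = J * τ⁻¹) (p : E[X]) :
    ((aeval τ p).map σ)ᵀ * J = J * aeval τ⁻¹ (p.map σ) := by
  have hsm : ∀ (c : E) (M : Matrix (Fin 3) (Fin 3) E), (c • M).map σ = σ c • M.map σ := fun c M => by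
    ext i j; simp [smul_eq_mul]
  induction p using Polynomial.induction_on' with
  | add p q hp hq =>
    rw [map_add, Matrix.map_add, Matrix.transpose_add, Matrix.add_mul, hp, hq, Polynomial.map_add, map_add, Matrix.mul_add]
    exact fun a b => map_add σ a b
  | monomial n c =>
    rw [Polynomial.map_monomial, aeval_monomial, aeval_monomial, Algebra.algebraMap_eq_smul_one, Algebra.algebraMap_eq_smul_one, smul_mul_assoc,
      smul_mul_assoc, Matrix.one_mul, Matrix.one_mul, hsm, Matrix.map_pow, Matrix.transpose_smul, Matrix.transpose_pow, smul_mul_assoc,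
      transpose_map_pow_mul_eq σ τ J hτJ n, Matrix.mul_smul]

include hσK in
/-- `star (P(x₀)) = P^σ(star x₀)` for `star = (σ, σ_K)` on `E × K`. [cite: Lang2002, Ch. V §2] -/
theorem prodMap_aeval_eq (x₀ : E × K) (P : E[X]) :
    RingHom.prodMap σ σK (aeval x₀ P) = aeval (RingHom.prodMap σ σK x₀) (P.map σ) := by
  refine Polynomial.map_aeval_eq_aeval_map ?_ P x₀
  ext c
  · rfl
  · change algebraMap E K (σ c) = σK (algebraMap E K c)
    rw [hσK]

include hσK in
/-- **THE ADJOINT RELATION FOR THE BRIDGE**: with `τ` unitary for the `σ`-hermitian `J` (`(στ)ᵀJτ = J`), `x₀ = (u, λ₁)` with `x₀ · star x₀ = 1`, and `φ : E × K →ₐ[E] M₃(E)` with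
`φ x₀ = τ` onto which every element is a polynomial in `x₀`: **`J · φ(star b) = (σ φ b)ᵀ · J`** for all `b`. [cite: Rogawski1990, §4.9 p. 55] [cite: Jacobowitz1962, §7] -/
theorem hstar_of_algHom_prod (hτJ : (τ.map σ)ᵀ * J * τ = J) (hτu : IsUnit τ.det)
    (hx₀ : ((u, lam) : E × K) * (σ u, σK lam) = 1)
    (hall : ∀ b : E × K, ∃ P : E[X], aeval ((u, lam) : E × K) P = b)
    (φ : (E × K) →ₐ[E] Matrix (Fin 3) (Fin 3) E) (hφx : φ ((u, lam) : E × K) = τ) (b : E × K) :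
    J * φ (RingHom.prodMap σ σK b) = ((φ b).map σ)ᵀ * J := by
  classical
  have hτJ' : (τ.map σ)ᵀ * J = J * τ⁻¹ := by
    have h := congrArg (fun M => M * τ⁻¹) hτJ
    simp only [Matrix.mul_assoc, Matrix.mul_nonsing_inv _ hτu, Matrix.mul_one] at h
    exact h
  have hφinv : φ ((σ u, σK lam) : E × K) = τ⁻¹ := by
    have h1 : τ * φ ((σ u, σK lam) : E × K) = 1 := by rw [← hφx, ← map_mul, hx₀, map_one]
    exact (Matrix.inv_eq_right_inv h1).symm
  obtain ⟨P, rfl⟩ := hall b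
  rw [prodMap_aeval_eq σ σK hσK, ← aeval_algHom_apply, ← aeval_algHom_apply, hφx]
  change J * aeval (φ ((σ u, σK lam) : E × K)) (P.map σ) = _
  rw [hφinv, transpose_map_aeval_mul_eq σ τ J hτJ']

end Adjoint

/-! ## §5 The order `RB = 𝒪_E[x₀] ⊂ E × K` and `φ(RB) = 𝒪_E[τ]`; §6 the transport of `[C : R^×]` -/

section Order

variable {E : Type*} [Field E] [ValuativeRel E] {K : Type*} [Field K] [ValuativeRel K] [Algebra E K]
  (jO : 𝒪[E] →+* 𝒪[K]) (hjO : ∀ x : 𝒪[E], ((jO x : 𝒪[K]) : K) = algebraMap E K x) (uO : 𝒪[E]) (lamO : 𝒪[K])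
  (τ : Matrix (Fin 3) (Fin 3) E)

include hjO in
/-- The integral polynomial ring maps compatibly: `incl (P(uO, λO)) = P((u, λ₁))` in `E × K`. [cite: Lang2002, Ch. II §2] -/
theorem prodMap_subtype_eval₂_eq (P : (𝒪[E])[X]) :
    RingHom.prodMap (𝒪[E]).subtype (𝒪[K]).subtype (Polynomial.eval₂RingHom (RingHom.prod (RingHom.id 𝒪[E]) jO) (uO, lamO) P) =
      aeval (((uO : E), (lamO : K)) : E × K) (P.map (𝒪[E]).subtype) := by
  rw [coe_eval₂RingHom, Polynomial.hom_eval₂, aeval_def, eval₂_map]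
  congr 1
  ext c
  · rfl
  · exact hjO c

include hjO in
/-- **`φ(RB) = 𝒪_E[τ]`**: for `RB := incl(𝒪_E[(uO, λO)]) ≤ E × K` and an `E`-algebra map `φ` with `φ(u, λ₁) = τ`, the elements of `Algebra.adjoin 𝒪[E] {τ}` are exactly the `φ b`, `b ∈ RB`.
[cite: Lang2002, Ch. XIV §3] -/
theorem mem_adjoin_integer_iff_exists_mem_map (φ : (E × K) →ₐ[E] Matrix (Fin 3) (Fin 3) E) (hφx : φ (((uO : E), (lamO : K)) : E × K) = τ)
    (x : Matrix (Fin 3) (Fin 3) E) :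
    x ∈ Algebra.adjoin 𝒪[E] ({τ} : Set (Matrix (Fin 3) (Fin 3) E)) ↔
      ∃ b ∈ ((Polynomial.eval₂RingHom (RingHom.prod (RingHom.id 𝒪[E]) jO) (uO, lamO)).range).map
          (RingHom.prodMap (𝒪[E]).subtype (𝒪[K]).subtype), φ b = x := by
  rw [Algebra.adjoin_singleton_eq_range_aeval, AlgHom.mem_range]
  have key : ∀ P : (𝒪[E])[X], φ (aeval (((uO : E), (lamO : K)) : E × K) (P.map (𝒪[E]).subtype)) = aeval τ P := by
    intro P
    rw [← aeval_algHom_apply, hφx]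
    exact Polynomial.aeval_map_algebraMap E τ P
  constructor
  · rintro ⟨P, rfl⟩
    refine ⟨_, Subring.mem_map.2 ⟨_, ⟨P, rfl⟩, rfl⟩, ?_⟩
    rw [prodMap_subtype_eval₂_eq jO hjO uO lamO, key]
  · rintro ⟨b, hb, rfl⟩
    obtain ⟨r, ⟨P, rfl⟩, rfl⟩ := Subring.mem_map.1 hb
    exact ⟨P, by rw [prodMap_subtype_eval₂_eq jO hjO uO lamO, key]⟩

variable (σO : 𝒪[E] →+* 𝒪[E]) (σ : E →+* E) (hσO : ∀ x : 𝒪[E], ((σO x : 𝒪[E]) : E) = σ x)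
  (σKO : 𝒪[K] →+* 𝒪[K]) (σK : K →+* K) (hσKO : ∀ z : 𝒪[K], ((σKO z : 𝒪[K]) : K) = σK z)
  (hσv : ∀ x, valuation E (σ x) = valuation E x) (hσKv : ∀ z, valuation K (σK z) = valuation K z)

omit [Algebra E K] in
include hσO hσKO hσv hσKv in
/-- **TRANSPORT OF THE UNIT INDEX TO `E × K`.**  Along the injective `incl : 𝒪_E × 𝒪_K → E × K`, the unit group `R^×` of ★ [T2-c] (`(Units.map R.subtype).range`) maps onto `RB^×`
(`RB.toSubmonoid.units`, `RB = incl R`) and `C = N⁻¹R^×` onto `C_B = N_B⁻¹ RB^×` (`N = id·⋆`; a `c` with `c·c⋆ ∈ RB^×` has `|c| = 1` componentwise since `|σ·| = |·|`), so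
**`[C_B : RB^×] = [C : R^×]`** (Mathlib `Subgroup.relIndex_map_map_of_injective`). [cite: Jacobowitz1962, §7] [cite: Rogawski1990, §4.9 Lemma 4.9.3 p. 56] -/
theorem relIndex_units_map_prod_eq :
    ((((Polynomial.eval₂RingHom (RingHom.prod (RingHom.id 𝒪[E]) jO) (uO, lamO)).range).map
        (RingHom.prodMap (𝒪[E]).subtype (𝒪[K]).subtype)).toSubmonoid.units).relIndex
      (((((Polynomial.eval₂RingHom (RingHom.prod (RingHom.id 𝒪[E]) jO) (uO, lamO)).range).map
        (RingHom.prodMap (𝒪[E]).subtype (𝒪[K]).subtype)).toSubmonoid.units).comap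
        (MonoidHom.id (E × K)ˣ * Units.map (RingHom.prodMap σ σK).toMonoidHom)) =
    (Units.map ((Polynomial.eval₂RingHom (RingHom.prod (RingHom.id 𝒪[E]) jO) (uO, lamO)).range.subtype :
        (Polynomial.eval₂RingHom (RingHom.prod (RingHom.id 𝒪[E]) jO) (uO, lamO)).range →* 𝒪[E] × 𝒪[K])).range.relIndex
      ((Units.map ((Polynomial.eval₂RingHom (RingHom.prod (RingHom.id 𝒪[E]) jO) (uO, lamO)).range.subtype :
        (Polynomial.eval₂RingHom (RingHom.prod (RingHom.id 𝒪[E]) jO) (uO, lamO)).range →* 𝒪[E] × 𝒪[K])).range.comap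
        (MonoidHom.id (𝒪[E] × 𝒪[K])ˣ * Units.map (RingHom.prodMap σO σKO : 𝒪[E] × 𝒪[K] →* 𝒪[E] × 𝒪[K]))) := by
  set R := (Polynomial.eval₂RingHom (RingHom.prod (RingHom.id 𝒪[E]) jO) (uO, lamO)).range with hR
  set incl : 𝒪[E] × 𝒪[K] →+* E × K := RingHom.prodMap (𝒪[E]).subtype (𝒪[K]).subtype with hincl
  set V := (Units.map (R.subtype : R →* 𝒪[E] × 𝒪[K])).range with hV
  set VB := (R.map incl).toSubmonoid.units with hVB
  set N := MonoidHom.id (𝒪[E] × 𝒪[K])ˣ * Units.map (RingHom.prodMap σO σKO : 𝒪[E] × 𝒪[K] →* 𝒪[E] × 𝒪[K]) with hN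
  set NB := MonoidHom.id (E × K)ˣ * Units.map (RingHom.prodMap σ σK).toMonoidHom with hNB
  set Φ : (𝒪[E] × 𝒪[K])ˣ →* (E × K)ˣ := Units.map (incl : 𝒪[E] × 𝒪[K] →* E × K) with hΦ
  have hincl_inj : Function.Injective incl := by
    rintro ⟨a, b⟩ ⟨a', b'⟩ h
    have h' : ((a : E), (b : K)) = ((a' : E), (b' : K)) := h
    rw [Prod.mk.injEq] at h'
    exact Prod.ext (Subtype.ext h'.1) (Subtype.ext h'.2)
  have hΦinj : Function.Injective Φ := fun x y h => Units.ext (hincl_inj (congrArg Units.val h))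
  -- naturality of the norm
  have hnat' : ∀ y : 𝒪[E] × 𝒪[K], incl (RingHom.prodMap σO σKO y) = RingHom.prodMap σ σK (incl y) := by
    rintro ⟨a, b⟩; exact Prod.ext (hσO a) (hσKO b)
  have hnat : ∀ c : (𝒪[E] × 𝒪[K])ˣ, Φ (N c) = NB (Φ c) := by
    intro c
    apply Units.ext
    change incl ((c : 𝒪[E] × 𝒪[K]) * RingHom.prodMap σO σKO (c : 𝒪[E] × 𝒪[K])) = incl (c : 𝒪[E] × 𝒪[K]) * RingHom.prodMap σ σK (incl (c : 𝒪[E] × 𝒪[K]))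
    rw [map_mul, hnat']
  -- membership in `R.map incl` forces integrality and pulls back to `R`
  have hmemR : ∀ x : 𝒪[E] × 𝒪[K], incl x ∈ R.map incl ↔ x ∈ R := by
    intro x
    rw [Subring.mem_map]
    constructor
    · rintro ⟨y, hy, hyx⟩; rwa [← hincl_inj hyx]
    · intro hx; exact ⟨x, hx, rfl⟩
  -- (a) `V.map Φ = VB`
  have hVmap : V.map Φ = VB := by
    ext x
    rw [Subgroup.mem_map, hVB, Submonoid.mem_units_iff]
    constructor
    · rintro ⟨v, hv, rfl⟩
      rw [hV, mem_range_units_map_subtype_iff] at hv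
      refine ⟨?_, ?_⟩
      · change incl (v : 𝒪[E] × 𝒪[K]) ∈ (R.map incl).toSubmonoid
        exact (hmemR _).2 hv.1
      · rw [← map_inv]
        change incl (↑v⁻¹ : 𝒪[E] × 𝒪[K]) ∈ (R.map incl).toSubmonoid
        exact (hmemR _).2 hv.2
    · rintro ⟨h1, h2⟩
      obtain ⟨r, hr, hrx⟩ := Subring.mem_map.1 h1
      obtain ⟨r', hr', hr'x⟩ := Subring.mem_map.1 h2
      have hrr' : r * r' = 1 := hincl_inj (by rw [map_mul, hrx, hr'x, Units.mul_inv, map_one])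
      have hr'r : r' * r = 1 := by rw [mul_comm]; exact hrr'
      refine ⟨⟨r, r', hrr', hr'r⟩, ?_, Units.ext hrx⟩
      rw [hV, mem_range_units_map_subtype_iff]
      exact ⟨hr, hr'⟩
  -- (b) `(V.comap N).map Φ = VB.comap NB`
  have hCmap : (V.comap N).map Φ = VB.comap NB := by
    ext x
    rw [Subgroup.mem_map, Subgroup.mem_comap]
    constructor
    · rintro ⟨c, hc, rfl⟩
      rw [← hnat, ← hVmap]
      exact Subgroup.mem_map_of_mem Φ (Subgroup.mem_comap.1 hc)
    · intro hx
      -- integrality of `x`: `x·x⋆ ∈ RB ⊆ 𝒪 × 𝒪` with inverse there too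
      rw [hVB, Submonoid.mem_units_iff] at hx
      obtain ⟨r, hr, hrx⟩ := Subring.mem_map.1 hx.1
      obtain ⟨r', hr', hr'x⟩ := Subring.mem_map.1 hx.2
      have hNBval : ((NB x : (E × K)ˣ) : E × K) = (x : E × K) * RingHom.prodMap σ σK (x : E × K) := by
        rw [hNB, MonoidHom.mul_apply, Units.val_mul, MonoidHom.id_apply, Units.coe_map]; rfl
      -- valuations of the two coordinates of `x`
      obtain ⟨⟨a, z⟩, ⟨a', z'⟩, hxx', hx'x⟩ := x
      have hprod1 : a * σ a = (r.1 : E) ∧ z * σK z = (r.2 : K) := by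
        have h := hrx; rw [hNBval] at h
        exact ⟨(congrArg Prod.fst h).symm, (congrArg Prod.snd h).symm⟩
      have hprod2 : (a * σ a) * (r'.1 : E) = 1 ∧ (z * σK z) * (r'.2 : K) = 1 := by
        have h := (NB ⟨(a, z), (a', z'), hxx', hx'x⟩).mul_inv
        rw [hNBval, ← hr'x] at h
        exact ⟨congrArg Prod.fst h, congrArg Prod.snd h⟩
      have hva : valuation E a = 1 := by
        have h1 : valuation E (a * σ a) ≤ 1 := by rw [hprod1.1]; exact r.1.2
        have h2 : 1 ≤ valuation E (a * σ a) := by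
          have := congrArg (valuation E) hprod2.1
          rw [map_mul, map_one] at this
          by_contra hlt
          push Not at hlt
          have hle : valuation E ((r'.1 : 𝒪[E]) : E) ≤ 1 := r'.1.2
          have : valuation E (a * σ a) * valuation E ((r'.1 : 𝒪[E]) : E) < 1 := mul_lt_one_of_lt_of_le hlt hle
          exact absurd ‹valuation E (a * σ a) * _ = 1› this.ne
        have heq : valuation E (a * σ a) = 1 := le_antisymm h1 h2
        rw [map_mul, hσv, ← sq] at heq
        exact (pow_eq_one_iff.1 heq).resolve_right two_ne_zero
      have hvz : valuation K z = 1 := by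
        have h1 : valuation K (z * σK z) ≤ 1 := by rw [hprod1.2]; exact r.2.2
        have h2 : 1 ≤ valuation K (z * σK z) := by
          have := congrArg (valuation K) hprod2.2
          rw [map_mul, map_one] at this
          by_contra hlt
          push Not at hlt
          have hle : valuation K ((r'.2 : 𝒪[K]) : K) ≤ 1 := r'.2.2
          have : valuation K (z * σK z) * valuation K ((r'.2 : 𝒪[K]) : K) < 1 := mul_lt_one_of_lt_of_le hlt hle
          exact absurd ‹valuation K (z * σK z) * _ = 1› this.ne
        have heq : valuation K (z * σK z) = 1 := le_antisymm h1 h2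
        rw [map_mul, hσKv, ← sq] at heq
        exact (pow_eq_one_iff.1 heq).resolve_right two_ne_zero
      have hva' : valuation E a' = 1 := by
        have h := congrArg (fun p : E × K => valuation E p.1) hxx'
        simp only [Prod.fst_mul, Prod.fst_one, map_mul, map_one, hva, one_mul] at h
        exact h
      have hvz' : valuation K z' = 1 := by
        have h := congrArg (fun p : E × K => valuation K p.2) hxx'
        simp only [Prod.snd_mul, Prod.snd_one, map_mul, map_one, hvz, one_mul] at h
        exact h
      -- the integral preimage
      set c : (𝒪[E] × 𝒪[K])ˣ :=
        ⟨(⟨a, (Valuation.mem_integer_iff _ _).2 hva.le⟩, ⟨z, (Valuation.mem_integer_iff _ _).2 hvz.le⟩),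
         (⟨a', (Valuation.mem_integer_iff _ _).2 hva'.le⟩, ⟨z', (Valuation.mem_integer_iff _ _).2 hvz'.le⟩),
         hincl_inj (by rw [map_mul, map_one]; exact hxx'), hincl_inj (by rw [map_mul, map_one]; exact hx'x)⟩ with hc
      have hΦc : Φ c = ⟨(a, z), (a', z'), hxx', hx'x⟩ := Units.ext rfl
      refine ⟨c, ?_, hΦc⟩
      rw [Subgroup.mem_comap]
      have hmem : Φ (N c) ∈ V.map Φ := by
        rw [hnat, hΦc, hVmap, hVB, Submonoid.mem_units_iff]; exact hx
      obtain ⟨c', hc', hcc'⟩ := Subgroup.mem_map.1 hmem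
      rwa [← hΦinj hcc']
  rw [← hCmap, ← hVmap]
  exact Subgroup.relIndex_map_map_of_injective _ _ hΦinj

end Order

end Literature.NumberTheory.Automorphic

end
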